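import Summits.Ventures.WeilGRH.UniformConductorFloorLorentz
import HarnessLib

/-!
# GRH arm (rh-explicit, venture WeilGRH): the Lorentzian deficit bound and the floor theorem with the gain `e^{−2xt}/x`

Cell `rh-explicit`, WEIL TRACK — GRH ARM (weil-grh-1).  Second half of `UniformConductorFloorLorentz.lean`:

* `UniformFloor.lorentz_deficit_le`: for a test function `g` supported in `[-t, t]`, `k = g ⋆ g̃`, `a > 0`,
  `∫ e^{−a|u|} Re k(u) du ≤ (2/a)(1 − e^{−at}) ‖g‖₂²` — `|k(u)| ≤ ∫|g(y)||g(y−u)|dy`, the AM–GM inequality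
  `2|g(y)||g(y')| ≤ |g(y)|²1_{(−t,t)}(y') + |g(y')|²1_{(−t,t)}(y)`, Fubini, and the window bound
  `∫_{y−t}^{y+t} e^{−a|u|} du ≤ (2/a)(1 − e^{−at})` (`integral_exp_neg_mul_abs_indicator_le`);
* `UniformFloor.arch_lower_bound_lorentz`: `(ψ(x) + e^{−2xt}/x)‖g‖₂² ≤ (1/2π)∫|ĝ(1/2+iτ)|² Re ψ(x + iτ/2) dτ`;
* `UniformFloor.weilPositivityOnChar_of_phi_budget_lorentz`: for `χ` mod `q ≠ 1` of parity `κ`, `x = ¼ + κ/2`,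
  a cell certificate `ρ` for the primes (`UniformConductorFloorCellsBudget.lean`) and any `γ ≤ e^{−2xt}/x`:
  `log π − ψ(x) − γ + ρ ≤ log q ⇒ WeilPositivityOnChar χ t` (uniform in the values of `χ`, no `ζ` input).

## References

* A. Weil (1952), (11) with (5), (10) and the «lemme» p. 262 [Weil1952FormulesExplicites];
  H. L. Montgomery, R. C. Vaughan (2007), (12.22) [MontgomeryVaughan2007]; H. Yoshida (1992) §2, §6 [Yoshida1992].
-/

noncomputable section

open Complex Filter Set MeasureTheory
open scoped Real Topology ComplexConjugate ArithmeticFunction.vonMangoldt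

namespace Summit.Ventures.WeilGRH

open Literature.NumberTheory.LFunctions

namespace UniformFloor

variable {g : ℝ → ℂ}

/-! ## The deficit bound -/

/-- AM–GM restricted to the window: for `g` vanishing off `(−t, t)` and all `y, y'`,
`2|g(y)||g(y')| ≤ |g(y)|²·1_{(−t,t)}(y') + |g(y')|²·1_{(−t,t)}(y)`. [folklore] -/
theorem two_mul_norm_mul_norm_le_indicator (hg : IsWeilTest g) {t : ℝ} (hsupp : tsupport g ⊆ Icc (-t) t)
    (y y' : ℝ) :
    2 * (‖g y‖ * ‖g y'‖) ≤ ‖g y‖ ^ 2 * (Ioo (-t) t).indicator (fun _ ↦ (1 : ℝ)) y' +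
      ‖g y'‖ ^ 2 * (Ioo (-t) t).indicator (fun _ ↦ (1 : ℝ)) y := by
  have hχ0 : ∀ z, 0 ≤ (Ioo (-t) t).indicator (fun _ ↦ (1 : ℝ)) z :=
    fun z ↦ Set.indicator_nonneg (fun _ _ ↦ zero_le_one) _
  by_cases hy : g y = 0
  · rw [hy, norm_zero, zero_mul, mul_zero]
    exact add_nonneg (mul_nonneg (sq_nonneg _) (hχ0 _)) (mul_nonneg (sq_nonneg _) (hχ0 _))
  by_cases hy' : g y' = 0
  · rw [hy', norm_zero, mul_zero, mul_zero]
    exact add_nonneg (mul_nonneg (sq_nonneg _) (hχ0 _)) (mul_nonneg (sq_nonneg _) (hχ0 _))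
  have hyS : y ∈ Ioo (-t) t := mem_Ioo_of_ne_zero hg hsupp hy
  have hy'S : y' ∈ Ioo (-t) t := mem_Ioo_of_ne_zero hg hsupp hy'
  rw [indicator_of_mem hyS, indicator_of_mem hy'S, mul_one, mul_one]
  nlinarith [sq_nonneg (‖g y‖ - ‖g y'‖)]

/-- **THE LORENTZIAN DEFICIT BOUND**: for a test function `g` supported in `[-t, t]`, `k = g ⋆ g̃`, `a > 0`,
`∫ e^{−a|u|} Re k(u) du ≤ (2/a)(1 − e^{−at}) ‖g‖₂²`. [folklore] -/
theorem lorentz_deficit_le (hg : IsWeilTest g) {t : ℝ} (hsupp : tsupport g ⊆ Icc (-t) t)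
    {a : ℝ} (ha : 0 < a) :
    ∫ u : ℝ, Real.exp (-(a * |u|)) * (weilConv g (weilReflect g) u).re ≤
      2 / a * (1 - Real.exp (-(a * t))) * weilNorm2Sq g := by
  set k := weilConv g (weilReflect g) with hk
  set E : ℝ → ℝ := fun u ↦ Real.exp (-(a * |u|)) with hE
  set χS : ℝ → ℝ := (Ioo (-t) t).indicator (fun _ ↦ (1 : ℝ)) with hχS
  set N2 := weilNorm2Sq g with hN2
  set mbar : ℝ := 2 / a * (1 - Real.exp (-(a * t))) with hm
  have hgc : Continuous g := hg.1.continuous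
  have hN20 : 0 ≤ N2 := integral_nonneg fun _ ↦ by positivity
  have hEi : Integrable E := integrable_exp_neg_mul_abs ha
  have hE0 : ∀ u, 0 ≤ E u := fun u ↦ (Real.exp_pos _).le
  have hE1 : ∀ u, E u ≤ 1 := fun u ↦ by
    rw [hE]; exact Real.exp_le_one_iff.2 (by have := abs_nonneg u; nlinarith)
  have hχ0 : ∀ z, 0 ≤ χS z := fun z ↦ Set.indicator_nonneg (fun _ _ ↦ zero_le_one) _
  have hχ1 : ∀ z, χS z ≤ 1 := fun z ↦ Set.indicator_le_self' (fun _ _ ↦ zero_le_one) _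
  have hχm : Measurable χS := (measurable_const.indicator measurableSet_Ioo)
  have hI2 : Integrable (fun y : ℝ ↦ ‖g y‖ ^ 2) := by
    refine (hgc.norm.pow 2).integrable_of_hasCompactSupport ?_
    rw [pow_two]; exact hg.2.norm.mul_right
  have hkb : ∀ u, ‖k u‖ ≤ N2 := fun u ↦ norm_weilConv_weilReflect_le hg u
  -- (1) `Re k(u) ≤ ∫|g||g(·−u)| ≤ ½∫|g y|²(χ(y−u)+χ(y+u)) dy`
  have hstep1 : ∀ u : ℝ, (k u).re ≤ 1 / 2 * ∫ y : ℝ, ‖g y‖ ^ 2 * (χS (y - u) + χS (y + u)) := by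
    intro u
    have h1 : (k u).re ≤ ∫ y : ℝ, ‖g y‖ * ‖g (y - u)‖ :=
      (Complex.re_le_norm _).trans (norm_weilConv_weilReflect_le_integral_mul g u)
    have hIa : Integrable fun y : ℝ ↦ ‖g y‖ * ‖g (y - u)‖ :=
      (hgc.norm.mul (hgc.comp (continuous_id.sub continuous_const)).norm).integrable_of_hasCompactSupport
        hg.2.norm.mul_right
    have hg2m : Measurable fun y : ℝ ↦ ‖g y‖ ^ 2 := (hgc.norm.pow 2).measurable
    have hIb : Integrable fun y : ℝ ↦ ‖g y‖ ^ 2 * χS (y - u) :=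
      hI2.mono' (hg2m.mul (hχm.comp (measurable_id.sub measurable_const))).aestronglyMeasurable
        (Eventually.of_forall fun y ↦ by
          rw [Real.norm_of_nonneg (mul_nonneg (sq_nonneg _) (hχ0 _))]
          exact mul_le_of_le_one_right (sq_nonneg _) (hχ1 _))
    have hIc : Integrable fun y : ℝ ↦ ‖g y‖ ^ 2 * χS (y + u) :=
      hI2.mono' (hg2m.mul (hχm.comp (measurable_id.add measurable_const))).aestronglyMeasurable
        (Eventually.of_forall fun y ↦ by
          rw [Real.norm_of_nonneg (mul_nonneg (sq_nonneg _) (hχ0 _))]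
          exact mul_le_of_le_one_right (sq_nonneg _) (hχ1 _))
    have hIc' : Integrable fun y : ℝ ↦ ‖g (y - u)‖ ^ 2 * χS y := by
      have := hIc.comp_sub_right u
      refine this.congr (Eventually.of_forall fun y ↦ ?_)
      simp only [sub_add_cancel]
    have h2 : ∫ y : ℝ, ‖g y‖ * ‖g (y - u)‖ ≤
        ∫ y : ℝ, 1 / 2 * (‖g y‖ ^ 2 * χS (y - u) + ‖g (y - u)‖ ^ 2 * χS y) := by
      refine integral_mono hIa ((hIb.add hIc').const_mul _) fun y ↦ ?_
      have := two_mul_norm_mul_norm_le_indicator hg hsupp y (y - u)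
      simp only
      linarith
    have h3 : ∫ y : ℝ, 1 / 2 * (‖g y‖ ^ 2 * χS (y - u) + ‖g (y - u)‖ ^ 2 * χS y) =
        1 / 2 * ∫ y : ℝ, ‖g y‖ ^ 2 * (χS (y - u) + χS (y + u)) := by
      rw [integral_const_mul, integral_add hIb hIc']
      congr 1
      have e : ∫ y : ℝ, ‖g (y - u)‖ ^ 2 * χS y = ∫ y : ℝ, ‖g y‖ ^ 2 * χS (y + u) := by
        rw [← integral_sub_right_eq_self (fun y : ℝ ↦ ‖g y‖ ^ 2 * χS (y + u)) u]
        refine integral_congr_ae (Eventually.of_forall fun y ↦ ?_)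
        simp only [sub_add_cancel]
      rw [e, ← integral_add hIb hIc]
      refine integral_congr_ae (Eventually.of_forall fun y ↦ ?_)
      simp only; ring
    linarith
  -- (2) joint integrability of `(u, y) ↦ E u |g y|² (χ(y−u) + χ(y+u))`
  have hF : Integrable (Function.uncurry fun u y : ℝ ↦ E u * (‖g y‖ ^ 2 * (χS (y - u) + χS (y + u))))
      (volume.prod volume) := by
    refine ((hEi.mul_prod hI2).const_mul 2).mono' ?_ (Eventually.of_forall ?_)
    · have hm1 : Measurable fun p : ℝ × ℝ ↦ E p.1 :=
        (Real.continuous_exp.comp ((continuous_const.mul (continuous_abs.comp continuous_fst)).neg)).measurable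
      have hm2 : Measurable fun p : ℝ × ℝ ↦ ‖g p.2‖ ^ 2 := ((hgc.comp continuous_snd).norm.pow 2).measurable
      have hm3 : Measurable fun p : ℝ × ℝ ↦ χS (p.2 - p.1) + χS (p.2 + p.1) :=
        (hχm.comp (measurable_snd.sub measurable_fst)).add (hχm.comp (measurable_snd.add measurable_fst))
      exact (hm1.mul (hm2.mul hm3)).aestronglyMeasurable
    · rintro ⟨u, y⟩
      simp only [Function.uncurry_apply_pair]
      have h01 : 0 ≤ χS (y - u) + χS (y + u) := add_nonneg (hχ0 _) (hχ0 _)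
      have h02 : χS (y - u) + χS (y + u) ≤ 2 := by linarith [hχ1 (y - u), hχ1 (y + u)]
      rw [Real.norm_of_nonneg (mul_nonneg (hE0 u) (mul_nonneg (sq_nonneg _) h01))]
      have : 0 ≤ E u * ‖g y‖ ^ 2 := mul_nonneg (hE0 u) (sq_nonneg _)
      nlinarith
  -- (3) integrate in `u`, swap, and bound the inner `u`-integral by `2 m̄`
  have hIL : Integrable fun u : ℝ ↦ E u * (k u).re := by
    refine (hEi.mul_const N2).mono' ?_ (Eventually.of_forall fun u ↦ ?_)
    · exact ((Real.continuous_exp.comp ((continuous_const.mul continuous_abs).neg)).mul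
        (Complex.continuous_re.comp (hg.weilConv hg.weilReflect).1.continuous)).aestronglyMeasurable
    · rw [norm_mul, Real.norm_of_nonneg (hE0 u)]
      exact mul_le_mul_of_nonneg_left ((Complex.abs_re_le_norm _).trans (hkb u)) (hE0 u)
  have hIR : Integrable fun u : ℝ ↦ E u * (1 / 2 * ∫ y : ℝ, ‖g y‖ ^ 2 * (χS (y - u) + χS (y + u))) := by
    have := hF.integral_prod_left.const_mul (1 / 2)
    refine this.congr (Eventually.of_forall fun u ↦ ?_)
    simp only [Function.uncurry_apply_pair]
    rw [integral_const_mul]; ring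
  have step3 : ∫ u : ℝ, E u * (k u).re ≤
      ∫ u : ℝ, E u * (1 / 2 * ∫ y : ℝ, ‖g y‖ ^ 2 * (χS (y - u) + χS (y + u))) :=
    integral_mono hIL hIR fun u ↦ mul_le_mul_of_nonneg_left (hstep1 u) (hE0 u)
  have step4 : ∫ u : ℝ, E u * (1 / 2 * ∫ y : ℝ, ‖g y‖ ^ 2 * (χS (y - u) + χS (y + u))) =
      1 / 2 * ∫ y : ℝ, ‖g y‖ ^ 2 * ∫ u : ℝ, E u * (χS (y - u) + χS (y + u)) := by
    calc ∫ u : ℝ, E u * (1 / 2 * ∫ y : ℝ, ‖g y‖ ^ 2 * (χS (y - u) + χS (y + u)))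
        = 1 / 2 * ∫ u : ℝ, ∫ y : ℝ, E u * (‖g y‖ ^ 2 * (χS (y - u) + χS (y + u))) := by
          rw [← integral_const_mul]
          refine integral_congr_ae (Eventually.of_forall fun u ↦ ?_)
          simp only
          rw [integral_const_mul]
          ring
      _ = 1 / 2 * ∫ y : ℝ, ∫ u : ℝ, E u * (‖g y‖ ^ 2 * (χS (y - u) + χS (y + u))) := by
          rw [integral_integral_swap hF]
      _ = 1 / 2 * ∫ y : ℝ, ‖g y‖ ^ 2 * ∫ u : ℝ, E u * (χS (y - u) + χS (y + u)) := by
          congr 1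
          refine integral_congr_ae (Eventually.of_forall fun y ↦ ?_)
          simp only
          rw [← integral_const_mul]
          refine integral_congr_ae (Eventually.of_forall fun u ↦ ?_)
          simp only; ring
  -- the inner bound
  have hinner : ∀ y : ℝ, ‖g y‖ ^ 2 * ∫ u : ℝ, E u * (χS (y - u) + χS (y + u)) ≤ ‖g y‖ ^ 2 * (2 * mbar) := by
    intro y
    by_cases hgy : g y = 0
    · simp [hgy]
    have hyS := mem_Ioo_of_ne_zero hg hsupp hgy
    refine mul_le_mul_of_nonneg_left ?_ (sq_nonneg _)
    have hEm : Measurable E :=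
      (Real.continuous_exp.comp ((continuous_const.mul continuous_abs).neg)).measurable
    have hIu1 : Integrable fun u : ℝ ↦ E u * χS (y - u) :=
      hEi.mono' (hEm.mul (hχm.comp (measurable_const.sub measurable_id))).aestronglyMeasurable
        (Eventually.of_forall fun u ↦ by
          rw [Real.norm_of_nonneg (mul_nonneg (hE0 _) (hχ0 _))]
          exact mul_le_of_le_one_right (hE0 _) (hχ1 _))
    have hIu2 : Integrable fun u : ℝ ↦ E u * χS (y + u) :=
      hEi.mono' (hEm.mul (hχm.comp (measurable_const.add measurable_id))).aestronglyMeasurable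
        (Eventually.of_forall fun u ↦ by
          rw [Real.norm_of_nonneg (mul_nonneg (hE0 _) (hχ0 _))]
          exact mul_le_of_le_one_right (hE0 _) (hχ1 _))
    have e : ∫ u : ℝ, E u * (χS (y - u) + χS (y + u)) =
        (∫ u : ℝ, E u * χS (y - u)) + ∫ u : ℝ, E u * χS (y + u) := by
      rw [← integral_add hIu1 hIu2]
      refine integral_congr_ae (Eventually.of_forall fun u ↦ ?_)
      simp only; ring
    have h1 : ∫ u : ℝ, E u * χS (y - u) ≤ mbar := integral_exp_neg_mul_abs_indicator_le ha hyS
    have h2 : ∫ u : ℝ, E u * χS (y + u) ≤ mbar := by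
      have hneg : ∫ u : ℝ, E u * χS (y + u) = ∫ u : ℝ, E u * χS (y - u) := by
        rw [← integral_neg_eq_self (fun u : ℝ ↦ E u * χS (y - u))]
        refine integral_congr_ae (Eventually.of_forall fun u ↦ ?_)
        simp only [hE, abs_neg, sub_neg_eq_add]
      rw [hneg]; exact h1
    rw [e]; linarith
  have hIy1 : Integrable fun y : ℝ ↦ ‖g y‖ ^ 2 * ∫ u : ℝ, E u * (χS (y - u) + χS (y + u)) := by
    have h := hF.swap.integral_prod_left
    refine h.congr (Eventually.of_forall fun y ↦ ?_)
    simp only [Function.comp_apply, Prod.swap_prod_mk, Function.uncurry_apply_pair]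
    rw [← integral_const_mul]
    refine integral_congr_ae (Eventually.of_forall fun u ↦ ?_)
    simp only; ring
  have step5 : ∫ y : ℝ, ‖g y‖ ^ 2 * ∫ u : ℝ, E u * (χS (y - u) + χS (y + u)) ≤
      ∫ y : ℝ, ‖g y‖ ^ 2 * (2 * mbar) :=
    integral_mono hIy1 (hI2.mul_const _) hinner
  rw [integral_mul_const] at step5
  calc ∫ u : ℝ, E u * (k u).re
      ≤ ∫ u : ℝ, E u * (1 / 2 * ∫ y : ℝ, ‖g y‖ ^ 2 * (χS (y - u) + χS (y + u))) := step3
    _ = 1 / 2 * ∫ y : ℝ, ‖g y‖ ^ 2 * ∫ u : ℝ, E u * (χS (y - u) + χS (y + u)) := step4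
    _ ≤ 1 / 2 * ((∫ y : ℝ, ‖g y‖ ^ 2) * (2 * mbar)) := by linarith
    _ = mbar * N2 := by rw [hN2, weilNorm2Sq]; ring
    _ = 2 / a * (1 - Real.exp (-(a * t))) * weilNorm2Sq g := by rw [hm, hN2]

/-! ## The sharpened archimedean bound and the floor theorem -/

/-- **ARCHIMEDEAN LOWER BOUND WITH THE LORENTZIAN IN POSITION SPACE**: for a test function `g` supported in
`[-t, t]` and `x > 0`, `(ψ(x) + e^{−2xt}/x)·‖g‖₂² ≤ (1/2π)∫|ĝ(1/2+iτ)|² Re ψ(x + iτ/2) dτ`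
(one vertical-series term; the deficit `∫ e^{−2x|u|} Re k ≤ (1/x)(1 − e^{−2xt})‖g‖₂²`). [folklore] -/
theorem arch_lower_bound_lorentz (hg : IsWeilTest g) {t : ℝ} (hsupp : tsupport g ⊆ Icc (-t) t)
    {x : ℝ} (hx : 0 < x) :
    ((digamma (x : ℂ)).re + Real.exp (-(2 * x * t)) / x) * weilNorm2Sq g ≤
      1 / (2 * π) * ∫ τ : ℝ, ‖weilMellin g (1 / 2 + τ * I)‖ ^ 2 *
        (digamma ((x : ℂ) + ((τ / 2 : ℝ) : ℂ) * I)).re := by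
  set N2 := weilNorm2Sq g with hN2
  set W : ℝ → ℝ := fun τ ↦ ‖weilMellin g (1 / 2 + τ * I)‖ ^ 2 with hW
  set L : ℝ → ℝ := fun τ ↦ x / (x ^ 2 + (τ / 2) ^ 2) with hL
  have hpt : ∀ τ : ℝ, W τ * ((digamma (x : ℂ)).re + 1 / x) - W τ * L τ ≤
      W τ * (digamma ((x : ℂ) + ((τ / 2 : ℝ) : ℂ) * I)).re := by
    intro τ
    have h := re_digamma_ge_sum x hx 1 τ
    simp only [Finset.sum_range_one, Nat.cast_zero, zero_add] at h
    have hW0 : 0 ≤ W τ := by positivity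
    rw [← mul_sub]
    exact mul_le_mul_of_nonneg_left (by rw [hL]; linarith) hW0
  have hIW : Integrable W := integrable_norm_sq_weilMellin_half_line hg
  have hIψ : Integrable fun τ : ℝ ↦ W τ * (digamma ((x : ℂ) + ((τ / 2 : ℝ) : ℂ) * I)).re := by
    refine (integrable_norm_sq_weilMellin_mul_re_digamma hg hx).congr (Eventually.of_forall fun τ ↦ ?_)
    simp only [hW]
    congr 3
    push_cast
    ring
  have hIL : Integrable fun τ : ℝ ↦ W τ * L τ :=
    integrable_norm_sq_weilMellin_mul hg (continuous_lorentz hx).measurable (A := 1 / x) (B := 0)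
      (by positivity) le_rfl fun τ ↦ by
        rw [abs_of_nonneg (lorentz_nonneg hx τ), zero_mul, add_zero]
        exact lorentz_le hx τ
  have hint : ∫ τ : ℝ, (W τ * ((digamma (x : ℂ)).re + 1 / x) - W τ * L τ) ≤
      ∫ τ : ℝ, W τ * (digamma ((x : ℂ) + ((τ / 2 : ℝ) : ℂ) * I)).re :=
    integral_mono (f := fun τ : ℝ ↦ W τ * ((digamma (x : ℂ)).re + 1 / x) - W τ * L τ)
      ((hIW.mul_const _).sub hIL) hIψ hpt
  rw [integral_sub (hIW.mul_const _) hIL, integral_mul_const] at hint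
  have hP : ∫ τ : ℝ, W τ = 2 * π * N2 := integral_norm_sq_weilMellin_half_line hg
  have hD : ∫ τ : ℝ, W τ * L τ = 2 * π * ∫ u : ℝ, Real.exp (-(2 * x * |u|)) * (weilConv g (weilReflect g) u).re :=
    lorentz_deficit_eq_integral hg hx
  have hDle := lorentz_deficit_le hg hsupp (a := 2 * x) (by positivity)
  have hπ : 0 < 2 * π := by positivity
  rw [show 1 / (2 * π) * ∫ τ : ℝ, W τ * (digamma ((x : ℂ) + ((τ / 2 : ℝ) : ℂ) * I)).re =
      (∫ τ : ℝ, W τ * (digamma ((x : ℂ) + ((τ / 2 : ℝ) : ℂ) * I)).re) / (2 * π) by ring, le_div_iff₀ hπ]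
  rw [hP, hD] at hint
  have e1 : 2 / (2 * x) * (1 - Real.exp (-(2 * x * t))) = (1 - Real.exp (-(2 * x * t))) / x := by
    field_simp
  rw [e1] at hDle
  have hN20 : 0 ≤ N2 := integral_nonneg fun _ ↦ by positivity
  have e2 : ((digamma (x : ℂ)).re + Real.exp (-(2 * x * t)) / x) * N2 * (2 * π) =
      2 * π * N2 * ((digamma (x : ℂ)).re + 1 / x) - 2 * π * ((1 - Real.exp (-(2 * x * t))) / x * N2) := by
    field_simp
    ring
  rw [e2]
  nlinarith [Real.pi_pos]

/-- **UNIFORM CONDUCTOR FLOOR, CELL CERTIFICATE + LORENTZIAN GAIN.**  For `χ` mod `q ≠ 1` of parity `κ`,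
`x = ¼ + κ/2`, `t > 0`, `e^{2t} ≤ N + 1`, `ψ₀ ≤ ψ(x)`, `γ ≤ e^{−2xt}/x`, and a `φ`-certificate with constant `ρ`
(`UniformConductorFloorCellsBudget.lean`): `log π − ψ₀ − γ + ρ ≤ log q ⇒ WeilPositivityOnChar χ t`.  Uniform in
the values of `χ`; no `ζ` input. [cite: Weil1952FormulesExplicites, (11) and the «lemme» p. 262; Yoshida1992, §2 (2.1), §6] -/
theorem weilPositivityOnChar_of_phi_budget_lorentz {q : ℕ} (hq : q ≠ 1) (χ : DirichletCharacter ℂ q) {κ : ℕ}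
    (hκ : charParity χ = κ) {t : ℝ} (ht : 0 < t) {N : ℕ} (hN : Real.exp (2 * t) ≤ (N : ℝ) + 1)
    {ψ₀ : ℝ} (hψ : ψ₀ ≤ (digamma (((1 / 4 + (κ : ℝ) / 2 : ℝ)) : ℂ)).re)
    {γ : ℝ} (hγ : γ ≤ Real.exp (-(2 * (1 / 4 + (κ : ℝ) / 2) * t)) / (1 / 4 + (κ : ℝ) / 2))
    {J : ℕ} (hJ : 0 < J) (φ : ℤ → ℝ) {Φ₀ Φ₁ : ℝ} (hΦ₀ : 0 < Φ₀)
    (hφlo : ∀ i, 0 ≤ i → i < (J : ℤ) → Φ₀ ≤ φ i) (hφhi : ∀ i, φ i ≤ Φ₁)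
    (hφout : ∀ i, i < 0 ∨ (J : ℤ) ≤ i → φ i = 0) (s : ℕ → ℕ)
    (hs : ∀ n ∈ Finset.range (N + 1),
      ((s n : ℤ) : ℝ) * (2 * t / J) ≤ Real.log n ∧ Real.log n ≤ (((s n : ℤ) : ℝ) + 1) * (2 * t / J))
    (wbar : ℕ → ℝ) (hw : ∀ n ∈ Finset.range (N + 1), (Λ n : ℝ) / Real.sqrt n ≤ wbar n) {ρ : ℝ}
    (hcert : ∀ j ∈ Finset.range J,
      ∑ n ∈ Finset.range (N + 1), wbar n *
        (max (φ ((j : ℤ) - s n - 1)) (φ ((j : ℤ) - s n)) + max (φ ((j : ℤ) + s n)) (φ ((j : ℤ) + s n + 1))) ≤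
        ρ * φ (j : ℤ))
    (hB : Real.log π - ψ₀ - γ + ρ ≤ Real.log q) :
    WeilPositivityOnChar χ t := by
  intro g hg hsupp
  set k := weilConv g (weilReflect g) with hk
  set N2 := weilNorm2Sq g with hN2
  set x : ℝ := 1 / 4 + (κ : ℝ) / 2 with hx
  have hx0 : 0 < x := by positivity
  have hN20 : 0 ≤ N2 := integral_nonneg fun _ ↦ by positivity
  set A : ℝ := ∫ τ : ℝ, ‖weilMellin g (1 / 2 + τ * I)‖ ^ 2 *
    (digamma ((x : ℂ) + ((τ / 2 : ℝ) : ℂ) * I)).re with hA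
  have hre : (weilQuadraticChar χ g).re =
      -(weilPrimeTermChar χ k).re + (1 / (2 * π) * A + N2 * (Real.log q - Real.log π)) := by
    rw [weilQuadraticChar_eq_neg_prime_add hq χ hκ hg, Complex.add_re, Complex.neg_re, Complex.ofReal_re]
  have hkc : Continuous k := (hg.weilConv hg.weilReflect).1.continuous
  have hks : tsupport k ⊆ Icc (-(2 * t)) (2 * t) := tsupport_weilConv_weilReflect_subset hg.2 hsupp
  have hPn : ‖weilPrimeTermChar χ k‖ ≤
      ∑ n ∈ Finset.range (N + 1), (Λ n : ℝ) / Real.sqrt n * (2 * ‖k (Real.log n)‖) := by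
    rw [weilPrimeTermChar_eq_sum_of_tsupport_subset χ hkc hN hks]
    refine (norm_sum_le _ _).trans (Finset.sum_le_sum fun n _ ↦ ?_)
    have hΛ : 0 ≤ (Λ n : ℝ) / Real.sqrt n :=
      div_nonneg ArithmeticFunction.vonMangoldt_nonneg (Real.sqrt_nonneg _)
    have hcoef : ‖((Λ n : ℝ) : ℂ) / (Real.sqrt n : ℂ)‖ = (Λ n : ℝ) / Real.sqrt n := by
      rw [← Complex.ofReal_div, Complex.norm_real, Real.norm_of_nonneg hΛ]
    have hχ : ‖χ (n : ZMod q)‖ ≤ 1 := DirichletCharacter.norm_le_one χ _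
    have hneg : ‖k (-Real.log n)‖ = ‖k (Real.log n)‖ := by
      rw [hk, weilConv_weilReflect_neg, Complex.norm_conj]
    rw [norm_mul, hcoef]
    refine mul_le_mul_of_nonneg_left ?_ hΛ
    refine (norm_add_le _ _).trans ?_
    rw [norm_mul, norm_mul, Complex.norm_conj, hneg]
    have hk0 : 0 ≤ ‖k (Real.log n)‖ := norm_nonneg _
    nlinarith [mul_le_mul_of_nonneg_right hχ hk0]
  have hcertR := sum_two_mul_norm_weilConv_le_of_cert hg ht hsupp hJ φ hΦ₀ hφlo hφhi hφout N s hs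
    wbar hw hcert
  have hP : (weilPrimeTermChar χ k).re ≤ ρ * N2 :=
    (Complex.re_le_norm _).trans (hPn.trans hcertR)
  have hArch : ((digamma (x : ℂ)).re + Real.exp (-(2 * x * t)) / x) * N2 ≤ 1 / (2 * π) * A :=
    arch_lower_bound_lorentz hg hsupp hx0
  have hψN : ψ₀ * N2 ≤ (digamma (x : ℂ)).re * N2 := mul_le_mul_of_nonneg_right hψ hN20
  have hγN : γ * N2 ≤ Real.exp (-(2 * x * t)) / x * N2 := mul_le_mul_of_nonneg_right hγ hN20
  have hBN : (Real.log π - ψ₀ - γ + ρ) * N2 ≤ Real.log q * N2 :=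
    mul_le_mul_of_nonneg_right hB hN20
  rw [hre]
  nlinarith

end UniformFloor

end Summit.Ventures.WeilGRH

end
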